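import Summits.CriticalPhenomena.PercolationContinuityZ3.Theses.PercLupuEnvironment
import Literature.Probability.LatticeModels.CableGFFLevelSets

/-!
# Line `birth` — registered skeleton for the crux `UniformSubcriticalOneArm`
# (stmt-CriticalPhenomena-6987, route `PercLupuEnvironment`, rank 2)

Crux (fixed, by name): `PercLupuEnvironment.UniformSubcriticalOneArm` (T1) — for every version
`(Ω, P, g)` of the discrete GFF of `ℤ³` there is `σ₀ > 0` such that for every `ε > 0` ONE scale
`n` satisfies: for all `0 < σ ≤ σ₀` and all levels `m` with annealed
`θ(σ,m) = E P^{lupuWeight (m+σg)}(|C(0)| = ∞) = 0`, the annealed one-arm probability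
`π_n(σ,m) := E P^{lupuWeight (m+σg)}(0 ↔ ∂B(n) in B(n))` is `≤ ε`.

Notation below: `θ(σ,m)` and `π_n(σ,m)` are these two annealed integrals; "non-percolating"
means `θ(σ,m) = 0`.

THE LINE — the route's own two-layer plan `T1 ⇐ ContinuityAtPositiveDisorder ∧
CrossoverEquicontinuity`, made precise and NON-CIRCULAR (an Arzelà–Ascoli cut: pointwise decay at
each fixed disorder + equicontinuity in the disorder strength, uniformly in the scale, glued over a
finite `δ`-grid of disorders), on top of the regime decomposition of the LEVEL `m` that the route
text itself records ("for `m ≤ 0` it already follows from RayMonotone + SolvedEndAnchor; the content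
is `0 < m < m_c(σ)`"):

* `stub_nonposLevels` — NONPOSITIVE LEVELS `m ≤ 0`, ALL disorders `0 < σ ≤ 1`, uniformly (KNOWN
  modulo the named Literature fact `Lupu2016_cableSignClustersBounded`): along the ray
  `ψ ↦ σ⁻¹ψ − m/σ` the Lupu weights increase (`lupuWeight_le_smul_add`, `σ⁻¹ ≥ 1`, `−m/σ ≥ 0`), so
  quenched `P^{lupuWeight (m+σg)} ≤_st P^{lupuWeight g}` = the cable-GFF sign clusters at level
  `0`, whose annealed one-arm tends to `θ(1,0) = 0` (Lupu 2016 Prop. 5.5) by monotone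
  convergence — ONE `N(ε)` serves every `σ ≤ 1`, `m ≤ 0`; no non-percolation hypothesis. Size M.
* `stub_lowLevels` — LOW POSITIVE LEVELS `0 < m ≤ m₀` at small disorder `σ ≤ σ₀`, uniformly: SOME
  deep-subcritical floor `m₀ > 0` and `σ₀ > 0` with `π_n` eventually `≤ ε` — perturbative
  subcritical stability ("subcritical sea at density `≤ 1 − e^{−2(m₀+δ)²} ≪ p_c` + sparse finite
  GFF islands `{σ g > δ}`", the technology of the sibling crux `SubcriticalDisorderStability` in
  its easiest corner: both `m₀` and `σ₀` are the prover's to choose). Size L.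
* `stub_fixedDisorderDecay` — CONTINUITY AT EACH FIXED POSITIVE DISORDER (open; disordered-model
  content, NOT the conjunct): for every floor `m₀ > 0` there is `σ₀(m₀) > 0` such that for each
  FIXED `σ ∈ (0, σ₀]` and each `ε`, eventually in `n` (the threshold MAY DEPEND ON `σ`), every
  non-percolating level `m > m₀` has `π_n(σ,m) ≤ ε`; i.e. `θ(σ, m_c(σ)) = 0` for the weakly
  GFF-disordered model at each small disorder — continuity of a correlated-disorder transition in
  `d = 3`, known only at the solved end `σ = 1` (Lupu 2016: `m_c(1) = 0`, `θ(1,0) = 0`).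
* `stub_disorderEquicontinuity` — EQUICONTINUITY IN THE DISORDER STRENGTH, UNIFORMLY IN THE SCALE
  (open; this is where "uniformly through the LR → SR crossover" lives): there is `σ₀ > 0` such
  that for every `ε` there are `δ > 0` and `N` with: for all `n ≥ N`, all `σ, σ' ∈ (0, σ₀]` with
  `|σ − σ'| ≤ δ` and every non-percolating `m` at `σ` there is a non-percolating `m'` at `σ'` with
  `π_n(σ,m) ≤ π_n(σ',m') + ε`. Alone it asserts no decay at all (it holds, e.g., if the critical
  one-arm profile were constant in `σ`); the monotone coupling of `RayMonotone` gives it for free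
  only in the useless direction (chart `(κ,h) = (σ², m/σ)`, `h_c(κ) ~ a_c/σ → ∞`), so its content
  is a genuine comparison of two nearby weak disorders at arbitrarily large scales
  (Weinrib–Halperin relevant LR-correlated disorder `a = 1 < 2/ν`; arXiv:2403.18787).
* `UniformSubcriticalOneArm_of : Stubs.stub_nonposLevels → Stubs.stub_lowLevels →
  Stubs.stub_fixedDisorderDecay → Stubs.stub_disorderEquicontinuity → UniformSubcriticalOneArm`
  (the stub `Prop`s BY NAME; conclusion the route decl BY NAME), PROVED here (no `sorry`) by the
  finite-grid argument: `σ₀ := min (min σ₂ σ₃) (min σ₄ 1)`; given `ε`, take the modulus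
  `(δ, N₄)` of stub 4 at `ε/2`, the grid `σᵢ := min σ₀ ((i+1)δ)`, `i ≤ K := ⌈σ₀/δ⌉₊`, the
  thresholds `N₁, N₂` of stubs 1–2 at `ε/2` and `N₃ := max_{i ≤ K} N(σᵢ, ε/2)` of stub 3 (via
  `choose` + `Finset.sup`), and the ONE scale `n := max (max N₁ N₂) (max N₃ N₄)`; for `σ ≤ σ₀`
  and non-percolating `m`, `i := ⌊σ/δ⌋₊` gives `|σ − σᵢ| ≤ δ`, stub 4 moves `(σ,m)` to a
  non-percolating `(σᵢ, m')` at cost `ε/2`, and `π_n(σᵢ,m') ≤ ε/2` by the three-way split of the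
  level `m'` (`m' ≤ 0` stub 1 / `0 < m' ≤ m₀` stub 2 / `m₀ < m'` stub 3 at the grid point).
  The route's inline `let W := …` is `Literature…lupuWeight` definitionally (`lupuWeight_def` is
  `rfl`) and its three GFF hypotheses are `IsDiscreteGFF` definitionally.
* definitional consistency `nonposLevels_registered`, …, `disorderEquicontinuity_registered :
  Stubs.stub_* := stub_*` and the crux from the four registered stubs as an
  `example : UniformSubcriticalOneArm := UniformSubcriticalOneArm_of stub_nonposLevels
  stub_lowLevels stub_fixedDisorderDecay stub_disorderEquicontinuity` (an `example`, so no
  `sorry`-tainted proof of the crux enters the environment) — the skeleton IS the crux proof once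
  the four sorries are discharged.

Why all four stubs are load-bearing: stub 4 is the only statement relating two different
disorders, and it lands on a grid point with a level `m'` of unknown sign, so the bound at the grid
point needs stub 1 (`m' ≤ 0`, stated for `σ ≤ 1` with no smallness), stub 2 (`0 < m' ≤ m₀`) and
stub 3 (`m' > m₀`, stated only above the floor and only pointwise in `σ`); no three of them give
the uniform statement.  Neither open stub is the crux reworded: stub 3 lacks uniformity in `σ`
(its `N` may blow up as `σ → 0`, which is exactly what the crux forbids), stub 4 lacks any decay.

Disproof.lean: none filed for this crux (`ledger crux ls stmt-CriticalPhenomena-6987`: no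
workfiles, 2026-08-17); the negatives index of the summit (11 entries) has nothing on the Lupu
family.  No new route, no restatement of the crux.
-/

noncomputable section

open MeasureTheory ProbabilityTheory
open Literature.Probability.Percolation Literature.Probability.LatticeModels

namespace Summit.CriticalPhenomena.PercolationContinuityZ3.Cruxes.UniformSubcriticalOneArm.Birth

/-! ## §0 The four stub statements, name-keyed (what `UniformSubcriticalOneArm_of` takes) -/

namespace Stubs

/-- **Stub `Prop` 1 (`nonposLevels`)** — nonpositive levels, every disorder `σ ∈ (0,1]`:
the annealed one-arm of the Lupu family is eventually (in `n`) `≤ ε`, uniformly in `σ ≤ 1`,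
`m ≤ 0` (domination by the solved end `σ = 1, m = 0` + Lupu 2016 Prop. 5.5). [stub statement;
known modulo `Lupu2016_cableSignClustersBounded`] -/
def stub_nonposLevels : Prop :=
  ∀ (Ω : Type) [MeasurableSpace Ω] (P : Measure Ω) [IsProbabilityMeasure P]
    (g : Site 3 → Ω → ℝ), IsDiscreteGFF P g →
    ∀ ε : ℝ, 0 < ε → ∃ N : ℕ, ∀ n : ℕ, N ≤ n → ∀ σ : ℝ, 0 < σ → σ ≤ 1 → ∀ m : ℝ, m ≤ 0 →
      ∫ ω, (prodBernoulli (lupuWeight fun x => m + σ * g x ω)).real (siteToBoundary 3 n) ∂P ≤ ε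

/-- **Stub `Prop` 2 (`lowLevels`)** — some deep-subcritical floor `m₀ > 0` and disorder bound
`σ₀ > 0`: the annealed one-arm is eventually `≤ ε` uniformly in `0 < σ ≤ σ₀`, `0 < m ≤ m₀`
(perturbative subcritical stability under weak GFF disorder; no non-percolation hypothesis).
[stub statement; size L] -/
def stub_lowLevels : Prop :=
  ∀ (Ω : Type) [MeasurableSpace Ω] (P : Measure Ω) [IsProbabilityMeasure P]
    (g : Site 3 → Ω → ℝ), IsDiscreteGFF P g →
    ∃ m₀ : ℝ, 0 < m₀ ∧ ∃ σ₀ : ℝ, 0 < σ₀ ∧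
      ∀ ε : ℝ, 0 < ε → ∃ N : ℕ, ∀ n : ℕ, N ≤ n → ∀ σ : ℝ, 0 < σ → σ ≤ σ₀ →
        ∀ m : ℝ, 0 < m → m ≤ m₀ →
          ∫ ω, (prodBernoulli (lupuWeight fun x => m + σ * g x ω)).real (siteToBoundary 3 n) ∂P ≤ ε

/-- **Stub `Prop` 3 (`fixedDisorderDecay`, OPEN)** — continuity of the transition at each FIXED
small disorder: above every floor `m₀ > 0`, for `σ ≤ σ₀(m₀)` fixed, the annealed one-arm at
non-percolating levels `m > m₀` is eventually `≤ ε` (threshold allowed to depend on `σ`).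
[stub statement; open problem (disordered-model continuity, `θ(σ, m_c(σ)) = 0`)] -/
def stub_fixedDisorderDecay : Prop :=
  ∀ (Ω : Type) [MeasurableSpace Ω] (P : Measure Ω) [IsProbabilityMeasure P]
    (g : Site 3 → Ω → ℝ), IsDiscreteGFF P g →
    ∀ m₀ : ℝ, 0 < m₀ → ∃ σ₀ : ℝ, 0 < σ₀ ∧
      ∀ σ : ℝ, 0 < σ → σ ≤ σ₀ → ∀ ε : ℝ, 0 < ε → ∃ N : ℕ, ∀ n : ℕ, N ≤ n →
        ∀ m : ℝ, m₀ < m →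
          ∫ ω, (prodBernoulli (lupuWeight fun x => m + σ * g x ω)).real
              (percolatesAt (0 : Site 3)) ∂P = 0 →
          ∫ ω, (prodBernoulli (lupuWeight fun x => m + σ * g x ω)).real (siteToBoundary 3 n) ∂P ≤ ε

/-- **Stub `Prop` 4 (`disorderEquicontinuity`, OPEN)** — equicontinuity of the non-percolating
one-arm profile in the disorder strength, uniformly in the scale: for `σ, σ' ≤ σ₀` that are
`δ`-close and `n ≥ N`, every non-percolating `(σ, m)` is matched by a non-percolating `(σ', m')`
with `π_n(σ,m) ≤ π_n(σ',m') + ε`. [stub statement; open (crossover equicontinuity)] -/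
def stub_disorderEquicontinuity : Prop :=
  ∀ (Ω : Type) [MeasurableSpace Ω] (P : Measure Ω) [IsProbabilityMeasure P]
    (g : Site 3 → Ω → ℝ), IsDiscreteGFF P g →
    ∃ σ₀ : ℝ, 0 < σ₀ ∧ ∀ ε : ℝ, 0 < ε → ∃ δ : ℝ, 0 < δ ∧ ∃ N : ℕ, ∀ n : ℕ, N ≤ n →
      ∀ σ : ℝ, 0 < σ → σ ≤ σ₀ → ∀ σ' : ℝ, 0 < σ' → σ' ≤ σ₀ → |σ - σ'| ≤ δ →
        ∀ m : ℝ,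
          ∫ ω, (prodBernoulli (lupuWeight fun x => m + σ * g x ω)).real
              (percolatesAt (0 : Site 3)) ∂P = 0 →
          ∃ m' : ℝ,
            ∫ ω, (prodBernoulli (lupuWeight fun x => m' + σ' * g x ω)).real
                (percolatesAt (0 : Site 3)) ∂P = 0 ∧
            ∫ ω, (prodBernoulli (lupuWeight fun x => m + σ * g x ω)).real (siteToBoundary 3 n) ∂P ≤
              ∫ ω, (prodBernoulli (lupuWeight fun x => m' + σ' * g x ω)).real (siteToBoundary 3 n) ∂P
                + ε

end Stubs

/-! ## §1 The four registered stubs (the only `sorry`s of the file) -/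

/-- **stub 1 (registered) = `Stubs.stub_nonposLevels` spelled out** — for every version `g` of the
discrete GFF of `ℤ³` and every `ε > 0` there is `N` with: for all `n ≥ N`, all `0 < σ ≤ 1` and all
`m ≤ 0`, `E P^{lupuWeight (m + σ g)}(0 ↔ ∂B(n) in B(n)) ≤ ε`.  Proof route (KNOWN modulo the
named Literature fact): `lupuWeight (m + σ g) ≤ lupuWeight g` pointwise
(`lupuWeight_le_smul_add` with `c = σ⁻¹ ≥ 1`, `t = −m/σ ≥ 0`, applied to `ψ = m + σ g`), hence
quenched domination of the increasing event `siteToBoundary 3 n`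
(`prodBernoulli_real_mono_of_isUpperSet`); integrate; and
`E P^{lupuWeight g}(0 ↔ ∂B(n)) ↓ E P^{lupuWeight g}(|C(0)| = ∞) = 0` (monotone convergence along
the decreasing events, `Lupu2016_cableSignClustersBounded.integral_eq_zero`, route item
`SolvedEndAnchor` (i)).  Size M (measurability of the annealed integrand is the real work). -/
theorem stub_nonposLevels :
    ∀ (Ω : Type) [MeasurableSpace Ω] (P : Measure Ω) [IsProbabilityMeasure P]
      (g : Site 3 → Ω → ℝ), IsDiscreteGFF P g →
      ∀ ε : ℝ, 0 < ε → ∃ N : ℕ, ∀ n : ℕ, N ≤ n → ∀ σ : ℝ, 0 < σ → σ ≤ 1 → ∀ m : ℝ, m ≤ 0 →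
        ∫ ω, (prodBernoulli (lupuWeight fun x => m + σ * g x ω)).real (siteToBoundary 3 n) ∂P
          ≤ ε := by
  sorry

/-- **stub 2 (registered) = `Stubs.stub_lowLevels` spelled out** — for every version `g` of the
discrete GFF of `ℤ³` there are a floor `m₀ > 0` and `σ₀ > 0` such that for every `ε > 0` some `N`
has: for all `n ≥ N`, `0 < σ ≤ σ₀`, `0 < m ≤ m₀`, `E P^{lupuWeight (m + σ g)}(0 ↔ ∂B(n)) ≤ ε`.
Why plausibly true: by monotonicity in `m` it is the statement at the single level `m₀`; there
the field is `m₀ + σ g` with Bernoulli density `1 − e^{−2m₀²} ≪ p_c(ℤ³)` off the sparse islands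
`{σ g > δ}` = `{g > δ/σ}`, `δ/σ ≥ δ/σ₀ ≫ h_*(ℤ³)`, which are finite with radius tail
`exp(−c (δ/σ − h_*)² r / log r)` (Goswami–Rodriguez–Severo 2022 Thm 1.1); a one-scale
coarse-graining with sprinkled decoupling (Rodriguez–Sznitman 2013, Popov–Ráth 2015) gives
annealed one-arm `≤ e^{−c n} + e^{−c n/(σ₀² log n)} → 0` uniformly in `σ ≤ σ₀`.  Why it might
fail: GFF corridors `{g > δ/σ}` of length `n` cost only `exp(−c n/(σ² log n))`, so no uniform
EXPONENTIAL rate exists and the coarse-graining must tolerate defects at all scales (same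
mechanism as the sibling crux's why-might-fail).  Size L. -/
theorem stub_lowLevels :
    ∀ (Ω : Type) [MeasurableSpace Ω] (P : Measure Ω) [IsProbabilityMeasure P]
      (g : Site 3 → Ω → ℝ), IsDiscreteGFF P g →
      ∃ m₀ : ℝ, 0 < m₀ ∧ ∃ σ₀ : ℝ, 0 < σ₀ ∧
        ∀ ε : ℝ, 0 < ε → ∃ N : ℕ, ∀ n : ℕ, N ≤ n → ∀ σ : ℝ, 0 < σ → σ ≤ σ₀ →
          ∀ m : ℝ, 0 < m → m ≤ m₀ →
            ∫ ω, (prodBernoulli (lupuWeight fun x => m + σ * g x ω)).real (siteToBoundary 3 n) ∂P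
              ≤ ε := by
  sorry

/-- **stub 3 (registered) = `Stubs.stub_fixedDisorderDecay` spelled out (OPEN)** — for every
version `g` of the discrete GFF of `ℤ³` and every floor `m₀ > 0` there is `σ₀ > 0` such that for
every FIXED `0 < σ ≤ σ₀` and every `ε > 0` some `N = N(σ, ε)` has: for all `n ≥ N` and all
`m > m₀` with annealed `θ(σ,m) = 0`, the annealed one-arm `π_n(σ,m) ≤ ε`.  Since `π_n(σ,·)` is
nondecreasing and continuous in `m` (local event) and `{m | θ(σ,m) = 0}` is an initial interval,
this is `π_n(σ, m_c(σ)) → 0`, i.e. `θ(σ, m_c(σ)) = 0`: continuity of the weakly GFF-disordered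
transition at each fixed small disorder (the route's `ContinuityAtPositiveDisorder`), a statement
about a DIFFERENT (correlated) model for each `σ > 0`, not about Bernoulli(`p_c`).  Why plausibly
true: disorder is expected to smoothen transitions (at `σ = 1` it is Lupu's theorem `θ(1,0) = 0`,
`m_c(1) = 0`); the floor puts the regime on the short-range side `m/σ ≥ m₀/σ₀`.  Why it might
fail / why hard: continuity is open even for discrete-GFF level sets (DGRS 2023 prove sharpness,
decay "except at criticality"); no `d = 3` correlated model other than the cable GFF is known to
be continuous.  Size: open-problem (but strictly weaker than the crux: no uniformity in `σ`). -/
theorem stub_fixedDisorderDecay :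
    ∀ (Ω : Type) [MeasurableSpace Ω] (P : Measure Ω) [IsProbabilityMeasure P]
      (g : Site 3 → Ω → ℝ), IsDiscreteGFF P g →
      ∀ m₀ : ℝ, 0 < m₀ → ∃ σ₀ : ℝ, 0 < σ₀ ∧
        ∀ σ : ℝ, 0 < σ → σ ≤ σ₀ → ∀ ε : ℝ, 0 < ε → ∃ N : ℕ, ∀ n : ℕ, N ≤ n →
          ∀ m : ℝ, m₀ < m →
            ∫ ω, (prodBernoulli (lupuWeight fun x => m + σ * g x ω)).real
                (percolatesAt (0 : Site 3)) ∂P = 0 →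
            ∫ ω, (prodBernoulli (lupuWeight fun x => m + σ * g x ω)).real (siteToBoundary 3 n) ∂P
              ≤ ε := by
  sorry

/-- **stub 4 (registered) = `Stubs.stub_disorderEquicontinuity` spelled out (OPEN; the hardest
stub)** — for every version `g` of the discrete GFF of `ℤ³` there is `σ₀ > 0` such that for every
`ε > 0` there are `δ > 0` and `N` with: for all `n ≥ N`, all `σ, σ' ∈ (0, σ₀]` with
`|σ − σ'| ≤ δ`, and every level `m` with `θ(σ,m) = 0`, some level `m'` has `θ(σ',m') = 0` and
`π_n(σ,m) ≤ π_n(σ',m') + ε`.  In words: the non-percolating one-arm profiles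
`A_n(σ) := sup {π_n(σ,m) | θ(σ,m) = 0}` are `ε`–`δ` equicontinuous in `σ ∈ (0, σ₀]` for all
large `n` SIMULTANEOUSLY (the route's `CrossoverEquicontinuity`).  Non-vacuity: at `σ' ≤ 1` every
`m' ≤ 0` is non-percolating (stub 1's domination + Lupu), so a candidate `m'` always exists; the
content is the comparison.  Why plausibly true: for `σ, σ'` bounded away from `0` it is a
finite-range perturbation statement; near `σ → 0` both models are `o(1)`-perturbations of
near-critical Bernoulli percolation below the crossover length and disordered-critical above it,
and the bet is that the one-arm at the critical curve varies continuously through the crossover.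
Why it might fail: the monotone coupling (`RayMonotone`, chart `(κ,h) = (σ², m/σ)`) only compares
`(σ,m)` with `(σ',m')`, `σ ≤ σ'`, `m/σ ≤ m'/σ'`, and non-percolation transfers the OTHER way, so
near `σ → 0` (`h_c ~ a_c/σ → ∞`) nothing is free; with stub 3 in hand this stub is equivalent to
the crux, hence carries the conjunct's difficulty in the `σ → 0` corner (route review
2026-08-15).  Size: open-problem. -/
theorem stub_disorderEquicontinuity :
    ∀ (Ω : Type) [MeasurableSpace Ω] (P : Measure Ω) [IsProbabilityMeasure P]
      (g : Site 3 → Ω → ℝ), IsDiscreteGFF P g →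
      ∃ σ₀ : ℝ, 0 < σ₀ ∧ ∀ ε : ℝ, 0 < ε → ∃ δ : ℝ, 0 < δ ∧ ∃ N : ℕ, ∀ n : ℕ, N ≤ n →
        ∀ σ : ℝ, 0 < σ → σ ≤ σ₀ → ∀ σ' : ℝ, 0 < σ' → σ' ≤ σ₀ → |σ - σ'| ≤ δ →
          ∀ m : ℝ,
            ∫ ω, (prodBernoulli (lupuWeight fun x => m + σ * g x ω)).real
                (percolatesAt (0 : Site 3)) ∂P = 0 →
            ∃ m' : ℝ,
              ∫ ω, (prodBernoulli (lupuWeight fun x => m' + σ' * g x ω)).real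
                  (percolatesAt (0 : Site 3)) ∂P = 0 ∧
              ∫ ω, (prodBernoulli (lupuWeight fun x => m + σ * g x ω)).real (siteToBoundary 3 n) ∂P
                ≤ ∫ ω, (prodBernoulli (lupuWeight fun x => m' + σ' * g x ω)).real
                    (siteToBoundary 3 n) ∂P + ε := by
  sorry

/-! ## §2 Composition (kernel-checked, no `sorry`): the four stubs give the crux BY NAME -/

/-- **`UniformSubcriticalOneArm` from the four stubs** (hypotheses = the declared stub `Prop`s
by name; conclusion = the route decl `PercLupuEnvironment.UniformSubcriticalOneArm` by name; no
`sorry`).  The finite-grid (Arzelà–Ascoli) argument described in the module docstring. -/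
theorem UniformSubcriticalOneArm_of (h1 : Stubs.stub_nonposLevels) (h2 : Stubs.stub_lowLevels)
    (h3 : Stubs.stub_fixedDisorderDecay) (h4 : Stubs.stub_disorderEquicontinuity) :
    Summit.CriticalPhenomena.PercolationContinuityZ3.Theses.PercLupuEnvironment.UniformSubcriticalOneArm := by
  unfold Stubs.stub_nonposLevels at h1
  unfold Stubs.stub_lowLevels at h2
  unfold Stubs.stub_fixedDisorderDecay at h3
  unfold Stubs.stub_disorderEquicontinuity at h4
  -- the route's `let W := …` prefix is inlined by `intro` (zeta); `W ψ` is `lupuWeight ψ` by `rfl`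
  intro Ω _ P _ g hG hmean hcov
  have hgff : IsDiscreteGFF P g := ⟨hG, hmean, hcov⟩
  -- stub 2: the floor m₀ and its disorder bound σ₂
  obtain ⟨m₀, hm₀, σ₂, hσ₂, H2⟩ := h2 Ω P g hgff
  -- stub 3 at that floor: its disorder bound σ₃ (pointwise-in-σ thresholds)
  obtain ⟨σ₃, hσ₃, H3⟩ := h3 Ω P g hgff m₀ hm₀
  -- stub 4: its disorder bound σ₄ (equicontinuity modulus)
  obtain ⟨σ₄, hσ₄, H4⟩ := h4 Ω P g hgff
  -- the disorder bound of the crux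
  obtain ⟨σ₀, hσ₀def⟩ : ∃ σ₀ : ℝ, σ₀ = min (min σ₂ σ₃) (min σ₄ 1) := ⟨_, rfl⟩
  have hσ₀ : 0 < σ₀ := by rw [hσ₀def]; exact lt_min (lt_min hσ₂ hσ₃) (lt_min hσ₄ one_pos)
  have hσ₀₂ : σ₀ ≤ σ₂ := by rw [hσ₀def]; exact (min_le_left _ _).trans (min_le_left _ _)
  have hσ₀₃ : σ₀ ≤ σ₃ := by rw [hσ₀def]; exact (min_le_left _ _).trans (min_le_right _ _)
  have hσ₀₄ : σ₀ ≤ σ₄ := by rw [hσ₀def]; exact (min_le_right _ _).trans (min_le_left _ _)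
  have hσ₀₁ : σ₀ ≤ 1 := by rw [hσ₀def]; exact (min_le_right _ _).trans (min_le_right _ _)
  refine ⟨σ₀, hσ₀, fun ε hε => ?_⟩
  have hε2 : 0 < ε / 2 := half_pos hε
  -- stub 4's modulus at ε/2
  obtain ⟨δ, hδ, N₄, H4'⟩ := H4 (ε / 2) hε2
  -- stubs 1 and 2 at ε/2
  obtain ⟨N₁, H1'⟩ := h1 Ω P g hgff (ε / 2) hε2
  obtain ⟨N₂, H2'⟩ := H2 (ε / 2) hε2
  -- stub 3 at ε/2 as a plain threshold FUNCTION of the disorder (hypotheses pushed inside)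
  have H3'' : ∀ s : ℝ, ∃ N : ℕ, 0 < s → s ≤ σ₃ → ∀ n : ℕ, N ≤ n → ∀ m : ℝ, m₀ < m →
      ∫ ω, (prodBernoulli (lupuWeight fun x => m + s * g x ω)).real
          (percolatesAt (0 : Site 3)) ∂P = 0 →
      ∫ ω, (prodBernoulli (lupuWeight fun x => m + s * g x ω)).real (siteToBoundary 3 n) ∂P
        ≤ ε / 2 := by
    intro s
    by_cases hs : 0 < s ∧ s ≤ σ₃
    · obtain ⟨N, hN⟩ := H3 s hs.1 hs.2 (ε / 2) hε2
      exact ⟨N, fun _ _ => hN⟩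
    · exact ⟨0, fun h h' => (hs ⟨h, h'⟩).elim⟩
  choose Nf hNf using H3''
  -- the finite δ-grid of disorders σᵢ := min σ₀ ((i+1)δ), i ≤ K := ⌈σ₀/δ⌉₊
  obtain ⟨grid, hgrid⟩ : ∃ grid : ℕ → ℝ, ∀ i, grid i = min σ₀ (((i : ℝ) + 1) * δ) :=
    ⟨fun i => min σ₀ (((i : ℝ) + 1) * δ), fun _ => rfl⟩
  obtain ⟨K, hK⟩ : ∃ K : ℕ, K = ⌈σ₀ / δ⌉₊ := ⟨_, rfl⟩
  have hgrid_pos : ∀ i, 0 < grid i := fun i => by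
    rw [hgrid]; exact lt_min hσ₀ (mul_pos (by positivity) hδ)
  have hgrid_le : ∀ i, grid i ≤ σ₀ := fun i => by rw [hgrid]; exact min_le_left _ _
  -- stub 3's thresholds over the grid, and the ONE scale of the crux
  obtain ⟨N₃, hN₃⟩ : ∃ N₃ : ℕ, N₃ = (Finset.range (K + 1)).sup fun i => Nf (grid i) := ⟨_, rfl⟩
  have hN₃i : ∀ i, i ≤ K → Nf (grid i) ≤ N₃ := fun i hi => by
    rw [hN₃]
    exact Finset.le_sup (f := fun i => Nf (grid i)) (Finset.mem_range.2 (Nat.lt_succ_of_le hi))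
  refine ⟨max (max N₁ N₂) (max N₃ N₄), fun σ hσ hσle m hθ => ?_⟩
  have hn₁ : N₁ ≤ max (max N₁ N₂) (max N₃ N₄) := (le_max_left _ _).trans (le_max_left _ _)
  have hn₂ : N₂ ≤ max (max N₁ N₂) (max N₃ N₄) := (le_max_right _ _).trans (le_max_left _ _)
  have hn₃ : N₃ ≤ max (max N₁ N₂) (max N₃ N₄) := (le_max_left _ _).trans (le_max_right _ _)
  have hn₄ : N₄ ≤ max (max N₁ N₂) (max N₃ N₄) := (le_max_right _ _).trans (le_max_right _ _)
  -- locate σ on the grid: i := ⌊σ/δ⌋₊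
  obtain ⟨i, hi⟩ : ∃ i : ℕ, i = ⌊σ / δ⌋₊ := ⟨_, rfl⟩
  have hiK : i ≤ K := by
    rw [hi, hK]
    have : σ / δ ≤ σ₀ / δ := by gcongr
    exact (Nat.floor_le_floor this).trans (Nat.floor_le_ceil _)
  have hlow : (i : ℝ) * δ ≤ σ := by
    have h := Nat.floor_le (div_nonneg hσ.le hδ.le)
    rw [← hi] at h
    calc (i : ℝ) * δ ≤ σ / δ * δ := mul_le_mul_of_nonneg_right h hδ.le
      _ = σ := div_mul_cancel₀ σ hδ.ne'
  have hupp : σ < ((i : ℝ) + 1) * δ := by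
    have h := Nat.lt_floor_add_one (σ / δ)
    rw [← hi] at h
    calc σ = σ / δ * δ := (div_mul_cancel₀ σ hδ.ne').symm
      _ < ((i : ℝ) + 1) * δ := mul_lt_mul_of_pos_right h hδ
  have hdist : |σ - grid i| ≤ δ := by
    have e : ((i : ℝ) + 1) * δ = (i : ℝ) * δ + δ := by ring
    have hgi : grid i = min σ₀ (((i : ℝ) + 1) * δ) := hgrid i
    have hle₁ : grid i ≤ ((i : ℝ) + 1) * δ := by rw [hgi]; exact min_le_right _ _
    have hle₂ : σ ≤ grid i := by rw [hgi]; exact le_min hσle hupp.le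
    rw [abs_le]
    constructor <;> linarith
  -- stub 4 moves (σ, m) to a non-percolating (σᵢ, m') at cost ε/2
  obtain ⟨m', hθ', hcmp⟩ :=
    H4' _ hn₄ σ hσ (hσle.trans hσ₀₄) (grid i) (hgrid_pos i) ((hgrid_le i).trans hσ₀₄) hdist m hθ
  -- at the grid point: three-way split of the level m'
  have hbound :
      ∫ ω, (prodBernoulli (lupuWeight fun x => m' + grid i * g x ω)).real (siteToBoundary 3
        (max (max N₁ N₂) (max N₃ N₄))) ∂P ≤ ε / 2 := by
    rcases le_or_gt m' 0 with hm' | hm'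
    · -- nonpositive levels: stub 1 (σᵢ ≤ 1, no non-percolation hypothesis needed)
      exact H1' _ hn₁ (grid i) (hgrid_pos i) ((hgrid_le i).trans hσ₀₁) m' hm'
    rcases le_or_gt m' m₀ with hm'' | hm''
    · -- low positive levels 0 < m' ≤ m₀: stub 2 (σᵢ ≤ σ₂)
      exact H2' _ hn₂ (grid i) (hgrid_pos i) ((hgrid_le i).trans hσ₀₂) m' hm' hm''
    · -- high levels m₀ < m': stub 3 at the grid point σᵢ ≤ σ₃, consuming non-percolation
      exact hNf (grid i) (hgrid_pos i) ((hgrid_le i).trans hσ₀₃) _ ((hN₃i i hiK).trans hn₃)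
        m' hm'' hθ'
  exact hcmp.trans (by linarith)

/-! ## §3 Definitional consistency: the registered stubs feed the composition verbatim -/

/-- The registered stub 1, as spelled out, IS the name-keyed statement `Stubs.stub_nonposLevels`. -/
theorem nonposLevels_registered : Stubs.stub_nonposLevels := stub_nonposLevels

/-- The registered stub 2, as spelled out, IS the name-keyed statement `Stubs.stub_lowLevels`. -/
theorem lowLevels_registered : Stubs.stub_lowLevels := stub_lowLevels

/-- The registered stub 3, as spelled out, IS `Stubs.stub_fixedDisorderDecay`. -/
theorem fixedDisorderDecay_registered : Stubs.stub_fixedDisorderDecay := stub_fixedDisorderDecay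

/-- The registered stub 4, as spelled out, IS `Stubs.stub_disorderEquicontinuity`. -/
theorem disorderEquicontinuity_registered : Stubs.stub_disorderEquicontinuity :=
  stub_disorderEquicontinuity

/- **The skeleton IS the crux proof** (D-0027 §3.3): `UniformSubcriticalOneArm` from the four
registered stubs — an `example`, so that no `sorry`-tainted proof of the crux enters the
environment; it becomes the crux proof (to be proposed `--workitem stmt-CriticalPhenomena-6987`)
as soon as the four stubs are discharged. -/
example :
    Summit.CriticalPhenomena.PercolationContinuityZ3.Theses.PercLupuEnvironment.UniformSubcriticalOneArm :=
  UniformSubcriticalOneArm_of stub_nonposLevels stub_lowLevels stub_fixedDisorderDecay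
    stub_disorderEquicontinuity

end Summit.CriticalPhenomena.PercolationContinuityZ3.Cruxes.UniformSubcriticalOneArm.Birth

end
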